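import Summits.BirchSwinnertonDyer.BirchSwinnertonDyer.Theorems.CyclotomicUntwistPSLocalThreeTorsionBridge
import Summits.BirchSwinnertonDyer.BirchSwinnertonDyer.Theorems.CyclotomicUntwistPSKodairaDictionary
import HarnessLib

/-!
# LAW L-t3, part 2b: on the Kodaira-`IV` rows of the cyclic wild cell at `3` (`v₃Δ_min = 6`),
# **`W(ℚ₃)[3] ≠ 0 ⟺ c₆(W_ℤ)/3⁵ ≡ 1 (mod 3) ⟺ c₃ = 3`**; the stable line is unique whenever
# `2v₃c₆ ≤ 3v₃c₄ + 1` and `3 ∤ v₃c₆`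

Cell `pub/bsd-wall` (D-0145 line `route-BirchSwinnertonDyer-CyclotomicUntwist`), seat `bsd-line-cycu-p2`
(prover seat 2/3, gen 3), helper toward K1 `PSRankOneLowerHalfAtThree` (stmt-BirchSwinnertonDyer-21580) and
K2 `PSRankOneUpperHalfAtThree` (stmt-21581). THEOREMS ONLY (no definition, no named fact, no `sorry`); BSD is
not proved by this file and no crux is. Sequel of `…PSLocalThreeTorsionBridge.lean` (squares in `ℚ₃`, the
`ET1` bridge, uniqueness of the root of the short-model `Ψ₃`), of `…PSLocalThreeTorsionStar.lean` (p604483: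
the `IV*`/`II*` rows have `W(ℚ₃)[3] = 0`) and of LAW L-c3 (`…PSTamagawaThreeLaw.lean`, p601441).

* §1 **`exists_isUniqueStableLineThree_of_lt`**: every elliptic `W/ℚ` with `c₄c₆ ≠ 0`,
  `2·v₃c₆ ≤ 3·v₃c₄ + 1` and `3 ∤ v₃c₆` has EXACTLY ONE `ℚ₃`-root of `Ψ₃` (`IsUniqueStableLineThree`, the
  O6 lane's census column `nroots = 1`): shift to `W.toShortNF • W` (`u = 1`, `A = −c₄/48`, `B = −c₆/864`,
  `v₃A = v₃c₄ − 1`, `v₃B = v₃c₆ − 3`), E89's Hensel root (`PsiThreeAdic.psi3_exists_root_valuation_of_lt`)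
  and part 2a's `psi3_root_unique`.
* §2 the Kodaira-`IV` rows of the route (`K₃ = IV`, `v₃Δ_min = 6`; globally minimal `W`): `v₃c₆ = 5`
  (`padicValInt_c₆_eq_five_of_kodairaIV`) and `v₃c₄ ≥ 3` (`c₄³ = c₆² + 1728Δ`), so §1 applies;
  **`not_noLocalThreeTorsionAt_three_iff_c₆_of_kodairaIV`**: `W(ℚ₃)[3] ≠ 0 ⟺ c₆(W_ℤ)/3⁵ % 3 = 1` — the sign
  of the unique stable line is `(−1/216)·c₆·w` (V10 `stableLineSignThree_eq_c₆_mul`), a square iff `−216·c₆`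
  is (`GaloisImage.LocalTorsion3.isSquare_iff_of_norm_sub_le`, `isSquare_intCast_padic_three_iff`);
  with LAW L-c3 the headline **`exists_three_torsion_iff_localTamagawaNumber_eq_three_of_kodairaIV`**:
  `(∃ P ∈ W(ℚ₃), P ≠ 0 ∧ 3P = 0) ⟺ c₃ = 3` — at the prime `3` itself the O6 law "`E(ℚ_q)[3] ≠ 0 ⟺ c_q = 3`"
  (tree, `q ≠ 3`) HOLDS on the `IV` rows (and fails on the `IV*` rows, part 1); census spelling
  `…_of_classO6_of_six` (`ClassO6 W 3`, `v = 6`).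

Numerics (this seat, `census/lt3_check.py`; EVIDENCE only): `81 ∥ N < 30 000`, `v₃Δ_min = 6`: 554 curves,
`E(ℚ₃)[3] ≠ 0` on 314, law 554/554.

References: J.-P. Serre, Invent. Math. 15 (1972) §1.11 [Serre1972]; J. H. Silverman, *AEC* (2009) III.1,
Ex. 3.7 [SilvermanAEC2009]; *ATAEC* (1994) IV.9.4 Step 5 [SilvermanATAEC1994]; J.-P. Serre, *A Course in
Arithmetic* (1973) II §3.3 [Serre1973].
-/

set_option autoImplicit false
-- single-conjunct summit: `Summit.BirchSwinnertonDyer.BirchSwinnertonDyer.…` repeats the name by design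
set_option linter.dupNamespace false

noncomputable section

open scoped Classical

open Polynomial WeierstrassCurve IsDedekindDomain Rat.HeightOneSpectrum
  Literature.NumberTheory.EllipticCurves Literature.NumberTheory.EllipticCurves.Rank1Residual
  Summit.BirchSwinnertonDyer.Rank1Residual.Additive Summit.BirchSwinnertonDyer.Rank1Residual.O5
  Summit.BirchSwinnertonDyer.Rank1Residual.Additive.PsiThreeAdic
  Summit.BirchSwinnertonDyer.Rank1Residual.GaloisImage.LocalTorsion3

namespace Summit.BirchSwinnertonDyer.BirchSwinnertonDyer.Theorems.PSLocalThreeTorsion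

/-! ## §1 One stable line whenever `2v₃c₆ ≤ 3v₃c₄ + 1` and `3 ∤ v₃c₆` -/

section ShortModel

variable (W : WeierstrassCurve ℚ) [W.IsElliptic]

omit [W.IsElliptic] in
/-- `W.toShortNF` has `u = 1`. [folklore] -/
theorem toShortNF_u_eq_one' : W.toShortNF.u = 1 := by
  rw [toShortNF, VariableChange.mul_def]
  simp [toCharNeTwoNF]

/-- `v₃(3ᵃ·c) = a` for a natural `c` prime to `3`, in `padicValRat` currency. [folklore] -/
theorem padicValRat_three_pow_mul (a c : ℕ) (hc : ¬ 3 ∣ c) :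
    padicValRat 3 (((3 ^ a * c : ℕ) : ℚ)) = a := by
  have hc0 : c ≠ 0 := by rintro rfl; exact hc (dvd_zero 3)
  rw [padicValRat.of_nat, padicValNat.mul (by positivity) hc0, padicValNat.prime_pow,
    padicValNat.eq_zero_of_not_dvd hc]
  simp

/-- `v₃(48) = 1`. [folklore] -/
theorem padicValRat_three_fortyeight : padicValRat 3 (48 : ℚ) = 1 := by
  have h := padicValRat_three_pow_mul 1 16 (by norm_num)
  norm_num at h
  exact_mod_cast h

/-- `v₃(864) = 3`. [folklore] -/
theorem padicValRat_three_864 : padicValRat 3 (864 : ℚ) = 3 := by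
  have h := padicValRat_three_pow_mul 3 32 (by norm_num)
  norm_num at h
  exact_mod_cast h

omit [W.IsElliptic] in
/-- **One stable line.** For `W/ℚ` with `c₄c₆ ≠ 0`, `2·v₃c₆ ≤ 3·v₃c₄ + 1` and `3 ∤ v₃c₆`, `Ψ₃` has
exactly one root in `ℚ₃` (`IsUniqueStableLineThree`). [cite: Serre1972, §1.11] [cite: Cremona1997, §3.8] -/
theorem exists_isUniqueStableLineThree_of_lt (h₄ : W.c₄ ≠ 0) (h₆ : W.c₆ ≠ 0)
    (hreg : 2 * padicValRat 3 W.c₆ ≤ 3 * padicValRat 3 W.c₄ + 1)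
    (h3 : ¬ (3 : ℤ) ∣ padicValRat 3 W.c₆) : ∃ x₀, IsUniqueStableLineThree W x₀ := by
  have hu : W.toShortNF.u = 1 := toShortNF_u_eq_one' W
  haveI hSh : (W.toShortNF • W).IsShortNF := W.toShortNF_spec
  have hc₄ : (W.toShortNF • W).c₄ = W.c₄ := by
    rw [variableChange_c₄, hu, inv_one, Units.val_one, one_pow, one_mul]
  have hc₆ : (W.toShortNF • W).c₆ = W.c₆ := by
    rw [variableChange_c₆, hu, inv_one, Units.val_one, one_pow, one_mul]
  have hA : (W.toShortNF • W).a₄ = -W.c₄ / 48 := by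
    have h := (W.toShortNF • W).c₄_of_isShortNF
    rw [hc₄] at h
    rw [h]; ring
  have hB : (W.toShortNF • W).a₆ = -W.c₆ / 864 := by
    have h := (W.toShortNF • W).c₆_of_isShortNF
    rw [hc₆] at h
    rw [h]; ring
  have hA0 : (W.toShortNF • W).a₄ ≠ 0 := by
    rw [hA]; exact div_ne_zero (neg_ne_zero.mpr h₄) (by norm_num)
  have hB0 : (W.toShortNF • W).a₆ ≠ 0 := by
    rw [hB]; exact div_ne_zero (neg_ne_zero.mpr h₆) (by norm_num)
  have hvA : padicValRat 3 (W.toShortNF • W).a₄ = padicValRat 3 W.c₄ - 1 := by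
    rw [hA, padicValRat.div (neg_ne_zero.mpr h₄) (by norm_num), padicValRat.neg,
      padicValRat_three_fortyeight]
  have hvB : padicValRat 3 (W.toShortNF • W).a₆ = padicValRat 3 W.c₆ - 3 := by
    rw [hB, padicValRat.div (neg_ne_zero.mpr h₆) (by norm_num), padicValRat.neg, padicValRat_three_864]
  have hlt : 2 * padicValRat 3 (W.toShortNF • W).a₆ + 2 ≤ 3 * padicValRat 3 (W.toShortNF • W).a₄ := by
    rw [hvA, hvB]; omega
  have h3' : ¬ (3 : ℤ) ∣ padicValRat 3 (W.toShortNF • W).a₆ := by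
    rw [hvB]; omega
  obtain ⟨x, -, -, hx⟩ := psi3_exists_root_valuation_of_lt hA0 hB0 hlt
  have huniq : IsUniqueStableLineThree (W.toShortNF • W) x := by
    refine ⟨?_, fun r hr ↦ ?_⟩
    · rw [IsRoot.def, eval_Ψ₃_baseChange_of_isShortNF]; exact hx
    · rw [IsRoot.def, eval_Ψ₃_baseChange_of_isShortNF] at hr
      exact psi3_root_unique hA0 hB0 hlt h3' hr hx
  exact ⟨x + (W.toShortNF.r : ℚ_[3]),
    (isUniqueStableLineThree_smul_iff_of_u_eq_one W W.toShortNF hu x).mp huniq⟩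

end ShortModel

/-! ## §2 The Kodaira-`IV` rows of the route: `W(ℚ₃)[3] ≠ 0 ⟺ c₆/3⁵ ≡ 1 (mod 3) ⟺ c₃ = 3` -/

section RowsIV

variable (W : WeierstrassCurve ℚ) [W.IsElliptic] [W.IsGloballyMinimal]

/-- `v₃ c₆(W) = 5` on the Kodaira-`IV` rows with `v₃Δ_min = 6`, in `padicValRat` currency. [cite: Kraus1990, Théorème (p = 3)] -/
theorem padicValRat_c₆_eq_five_of_kodairaIV (hK : W.kodairaSymbolAt (placeOf 3) = .IV)
    (hv : padicValInt 3 W.minimalDiscriminantInt = 6) : padicValRat 3 W.c₆ = 5 := by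
  rw [← cast_integralModelInt_c₆, padicValRat.of_int]
  exact_mod_cast PSTamagawaThree.padicValInt_c₆_eq_five_of_kodairaIV W hK hv

/-- `c₆ ≠ 0`, `c₄ ≠ 0` and `v₃ c₄ ≥ 3` on the Kodaira-`IV` rows with `v₃Δ_min = 6` (`c₄³ = c₆² + 1728Δ`:
valuations `10` and `9` on the right). [cite: SilvermanAEC2009, III.1 (c-relation)] -/
theorem c₄_c₆_of_kodairaIV (hK : W.kodairaSymbolAt (placeOf 3) = .IV)
    (hv : padicValInt 3 W.minimalDiscriminantInt = 6) :
    W.c₄ ≠ 0 ∧ W.c₆ ≠ 0 ∧ 3 ≤ padicValRat 3 W.c₄ := by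
  have hv6 := padicValRat_c₆_eq_five_of_kodairaIV W hK hv
  have h₆ : W.c₆ ≠ 0 := by
    intro h0
    have h5 := PSTamagawaThree.padicValInt_c₆_eq_five_of_kodairaIV W hK hv
    have hz : (integralModelInt W).c₆ = 0 := by
      have := cast_integralModelInt_c₆ W
      rw [h0] at this
      exact_mod_cast this
    rw [hz] at h5
    simp at h5
  have hΔ : W.Δ ≠ 0 := W.coe_Δ' ▸ W.Δ'.ne_zero
  have hvΔ : padicValRat 3 W.Δ = 6 := by
    rw [← cast_minimalDiscriminantInt, padicValRat.of_int]; exact_mod_cast hv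
  have h1728 : padicValRat 3 (1728 : ℚ) = 3 := by
    have h := padicValRat_three_pow_mul 3 64 (by norm_num)
    norm_num at h
    exact_mod_cast h
  have hrel : W.c₄ ^ 3 = W.c₆ ^ 2 + 1728 * W.Δ := by linear_combination -W.c_relation
  have hv1 : padicValRat 3 (W.c₆ ^ 2) = 10 := by rw [padicValRat.pow, hv6]; norm_num
  have hv2 : padicValRat 3 (1728 * W.Δ) = 9 := by
    rw [padicValRat.mul (by norm_num) hΔ, h1728, hvΔ]; norm_num
  have hsum : W.c₆ ^ 2 + 1728 * W.Δ ≠ 0 := by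
    intro h0
    have e : W.c₆ ^ 2 = -(1728 * W.Δ) := by linear_combination h0
    have := congrArg (padicValRat 3) e
    rw [padicValRat.neg, hv1, hv2] at this
    norm_num at this
  have h₄ : W.c₄ ≠ 0 := by
    intro h0
    rw [h0, zero_pow three_ne_zero] at hrel
    exact hsum hrel.symm
  refine ⟨h₄, h₆, ?_⟩
  have hmin := padicValRat.min_le_padicValRat_add (p := 3) hsum
  rw [hv1, hv2, ← hrel, padicValRat.pow] at hmin
  norm_num at hmin
  omega

/-- **The Kodaira-`IV` rows are a one-stable-line locus.** [cite: Serre1972, §1.11] -/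
theorem exists_isUniqueStableLineThree_of_kodairaIV (hK : W.kodairaSymbolAt (placeOf 3) = .IV)
    (hv : padicValInt 3 W.minimalDiscriminantInt = 6) : ∃ x₀, IsUniqueStableLineThree W x₀ := by
  obtain ⟨h₄, h₆, h3⟩ := c₄_c₆_of_kodairaIV W hK hv
  have hv6 := padicValRat_c₆_eq_five_of_kodairaIV W hK hv
  exact exists_isUniqueStableLineThree_of_lt W h₄ h₆ (by rw [hv6]; omega) (by rw [hv6]; omega)

/-- **LAW L-t3 on the `IV` rows: `W(ℚ₃)[3] ≠ 0 ⟺ c₆(W_ℤ)/3⁵ ≡ 1 (mod 3)`** (`K₃ = IV`, `v₃Δ_min = 6`).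
The sign of the unique stable line is `(−1/216)·c₆·w` with `w` a principal unit, a square in `ℚ₃` iff
`−216·c₆ = 3⁸·(−8·c₆/3⁵)` is, iff `c₆/3⁵ ≡ 1 (mod 3)`. [cite: Serre1972, §1.11] [cite: Serre1973, Ch. II §3.3] -/
theorem not_noLocalThreeTorsionAt_three_iff_c₆_of_kodairaIV (hK : W.kodairaSymbolAt (placeOf 3) = .IV)
    (hv : padicValInt 3 W.minimalDiscriminantInt = 6) :
    ¬ NoLocalThreeTorsionAt W 3 ↔ (integralModelInt W).c₆ / 3 ^ 5 % 3 = 1 := by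
  obtain ⟨x₀, hx⟩ := exists_isUniqueStableLineThree_of_kodairaIV W hK hv
  have h5 := PSTamagawaThree.padicValInt_c₆_eq_five_of_kodairaIV W hK hv
  obtain ⟨hc₆, w, hw, hF⟩ := stableLineSignThree_eq_c₆_mul W hx
  -- (1) `W(ℚ₃)[3] ≠ 0 ⟺` the sign is a square
  have step1 : ¬ NoLocalThreeTorsionAt W 3 ↔ IsSquare (stableLineSignThree W x₀) := by
    rw [not_noLocalThreeTorsionAt_iff_exists]
    constructor
    · rintro ⟨x, s, hr, hs⟩
      rw [hx.2 x hr] at hs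
      exact ⟨s, by rw [← sq]; exact hs⟩
    · rintro ⟨s, hs⟩
      exact ⟨x₀, s, hx.1, by rw [sq]; exact hs⟩
  -- (2) `⟺ (−1/216)·c₆` is a square
  have hc0 : (-1 / 216 : ℚ_[3]) * (W.c₆ : ℚ_[3]) ≠ 0 :=
    mul_ne_zero (by norm_num) (by exact_mod_cast hc₆)
  have step2 : IsSquare (stableLineSignThree W x₀) ↔ IsSquare ((-1 / 216 : ℚ_[3]) * (W.c₆ : ℚ_[3])) := by
    refine (isSquare_iff_of_norm_sub_le hc0 ?_).2
    rw [hF, show (-1 / 216 : ℚ_[3]) * (W.c₆ : ℚ_[3]) * w - -1 / 216 * (W.c₆ : ℚ_[3]) =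
      (-1 / 216 * (W.c₆ : ℚ_[3])) * (w - 1) by ring, norm_mul, mul_comm]
    have hw' : ‖w - 1‖ ≤ 3⁻¹ := by
      -- Mathlib: `‖a‖ ≤ p^n ↔ ‖a‖ < p^(n+1)` (the tree's `WildCubic.padicNorm_le_third_of_lt_one`)
      have := (Padic.norm_le_pow_iff_norm_lt_pow_add_one (w - 1) (-1)).mpr (by simpa using hw)
      simpa using this
    exact mul_le_mul_of_nonneg_right hw' (norm_nonneg _)
  -- (3) `⟺ −216·c₆(W_ℤ)` is a square (rescale by the square `216²`)
  set n : ℤ := (integralModelInt W).c₆ with hn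
  have hcast : (W.c₆ : ℚ_[3]) = ((n : ℚ) : ℚ_[3]) := by rw [hn, cast_integralModelInt_c₆]
  have step3 : IsSquare ((-1 / 216 : ℚ_[3]) * (W.c₆ : ℚ_[3])) ↔ IsSquare (((-216 * n : ℤ) : ℚ) : ℚ_[3]) := by
    have e : (((-216 * n : ℤ) : ℚ) : ℚ_[3]) = ((-1 / 216 : ℚ_[3]) * (W.c₆ : ℚ_[3])) * (216 * 216) := by
      rw [hcast]; push_cast; ring
    rw [e]
    constructor
    · rintro ⟨r, hr⟩; exact ⟨r * 216, by rw [hr]; ring⟩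
    · rintro ⟨r, hr⟩
      refine ⟨r / 216, ?_⟩
      have h216 : (216 : ℚ_[3]) ≠ 0 := by norm_num
      field_simp
      linear_combination hr
  -- (4) the integer square class: `−216·n = 3⁸·(−8m)`, `m = n/3⁵`, `3 ∤ m`
  have hdvd : (3 : ℤ) ^ 5 ∣ n := by
    have := padicValInt_dvd (p := 3) n
    rw [h5] at this; exact_mod_cast this
  obtain ⟨m, hm⟩ := hdvd
  have hm3 : ¬ (3 : ℤ) ∣ m := by
    rintro ⟨k, rfl⟩
    have h6 : ((3 : ℕ) : ℤ) ^ 6 ∣ n := ⟨k, by rw [hm]; ring⟩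
    have hn0 : n ≠ 0 := by
      intro h0; rw [h0] at h5; simp at h5
    have := (padicValInt_dvd_iff 6 n).mp h6
    rw [h5] at this
    omega
  have hdiv : n / 3 ^ 5 = m := by rw [hm, Int.mul_ediv_cancel_left _ (by norm_num)]
  have h8 : (3 : ℤ) ^ 8 ∣ -216 * n := ⟨-8 * m, by rw [hm]; ring⟩
  have h9 : ¬ (3 : ℤ) ^ 9 ∣ -216 * n := by
    rintro ⟨k, hk⟩
    apply hm3
    refine ⟨k + 3 * m, ?_⟩
    have e : (3 : ℤ) ^ 8 * (-8 * m) = (3 : ℤ) ^ 8 * (3 * k) := by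
      rw [hm] at hk; linear_combination hk
    have e' := mul_left_cancel₀ (pow_ne_zero 8 (by norm_num : (3 : ℤ) ≠ 0)) e
    linarith
  have step4 := isSquare_intCast_padic_three_iff (-216 * n) 8 h8 h9
  have hq : (((-216 * n : ℤ) : ℚ) : ℚ_[3]) = ((-216 * n : ℤ) : ℚ_[3]) := by push_cast; ring
  rw [step1, step2, step3, hq, step4, hdiv,
    show -216 * n / 3 ^ 8 = -8 * m by rw [hm, show (-216 : ℤ) * (3 ^ 5 * m) = 3 ^ 8 * (-8 * m) by ring,
      Int.mul_ediv_cancel_left _ (by norm_num)]]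
  omega

/-- **HEADLINE: on the Kodaira-`IV` rows of the cyclic wild cell, `W(ℚ₃)` has a point of order `3` iff
`c₃ = 3`** (`K₃ = IV`, `v₃Δ_min = 6`; LAW L-t3 + LAW L-c3). At the prime `3` itself the O6 law
"`E(ℚ_q)[3] ≠ 0 ⟺ c_q = 3`" (tree `localThreeTorsionIffTamagawaThreeOfIV_holds`, `q ≠ 3`) thus HOLDS on the
`IV` rows and FAILS on the `IV*` rows (`…PSLocalThreeTorsionStar.lean`). [cite: SilvermanATAEC1994, IV.9.4 Step 5] [cite: Serre1972, §1.11] -/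
theorem exists_three_torsion_iff_localTamagawaNumber_eq_three_of_kodairaIV
    (hK : W.kodairaSymbolAt (placeOf 3) = .IV) (hv : padicValInt 3 W.minimalDiscriminantInt = 6) :
    (∃ P : (W.baseChange ℚ_[3]).toAffine.Point, P ≠ 0 ∧ 3 • P = 0) ↔
      (W.baseChange ℚ_[3]).localTamagawaNumber ℤ_[3] = 3 := by
  rw [exists_ne_zero_three_nsmul_iff_not_noLocalThreeTorsionAt W 3,
    not_noLocalThreeTorsionAt_three_iff_c₆_of_kodairaIV W hK hv,
    PSTamagawaThree.localTamagawaNumber_three_eq_three_iff_of_kodairaIV W hK hv]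

/-- **Census spelling**: on the wild cell (`ClassO6 W 3`) with `v₃Δ_min = 6` (then Kodaira `IV`,
`PSKodairaDictionary.kodairaSymbolAt_of_mod_four_eq_two`): `W(ℚ₃)[3] ≠ 0 ⟺ c₃ = 3 ⟺ c₆(W_ℤ)/3⁵ % 3 = 1`.
[cite: SilvermanATAEC1994, IV.9.4 Step 5] -/
theorem exists_three_torsion_iff_of_classO6_of_six (hO6 : ClassO6 W 3)
    (h6 : padicValInt 3 W.minimalDiscriminantInt = 6) :
    ((∃ P : (W.baseChange ℚ_[3]).toAffine.Point, P ≠ 0 ∧ 3 • P = 0) ↔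
        (W.baseChange ℚ_[3]).localTamagawaNumber ℤ_[3] = 3) ∧
      ((∃ P : (W.baseChange ℚ_[3]).toAffine.Point, P ≠ 0 ∧ 3 • P = 0) ↔
        (integralModelInt W).c₆ / 3 ^ 5 % 3 = 1) := by
  obtain ⟨-, hadd, hW⟩ := hO6
  rcases PSKodairaDictionary.kodairaSymbolAt_of_mod_four_eq_two W hadd hW (by omega) with ⟨hK, -⟩ | ⟨-, h⟩
  · exact ⟨exists_three_torsion_iff_localTamagawaNumber_eq_three_of_kodairaIV W hK h6,
      by rw [exists_ne_zero_three_nsmul_iff_not_noLocalThreeTorsionAt W 3,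
        not_noLocalThreeTorsionAt_three_iff_c₆_of_kodairaIV W hK h6]⟩
  · omega

end RowsIV

end Summit.BirchSwinnertonDyer.BirchSwinnertonDyer.Theorems.PSLocalThreeTorsion

end
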